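import Mathlib
import HarnessLib
import Summits.Ventures.LatticeQCDFlow.Scaling.SU3HaarSmallBall
import Summits.Ventures.LatticeQCDFlow.Scaling.SU3HaarSmallBallUpperSharp
import Summits.Ventures.LatticeQCDFlow.Scaling.AutoregressiveGaugeKLExtensiveAllPlanesLogMass

/-!
# LatticeQCDFlow / Scaling — THE SU(3) VOLUME LAW WITH THE FULL LOGARITHMIC COEFFICIENT: for every `t ≥ 2`,
# `(d·L^d/4)·((1 − 1/t)·(4·log(K/(17 + 3 log K)) − 4·log t − 8·log 2 − 3·log 3 + log(1 − 1/t)) − (log t)/t) ≤ KL`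
# and `τ_int(sign) ≥ exp(the same) − ½`, `K = (d−1)β` — exponent per site `(4 − o(1))·log β = (dim SU(3)/2)·log β`
# (the half-weight law had `3/2`)

HONEST FRAMING: exact (Metropolis-corrected) sampling algorithms for lattice gauge theory;
figures of merit are autocorrelation/cost numbers at stated couplings and volumes; no
continuum-physics claim.

Venture `LatticeQCDFlow` (cell pub-lqcd), topic `Scaling`, FANOUT row 30 (lean-1, GEN-22) — OUR WORK on
THEORY-2.md §4 row C5: the `SU(3)` instance of the OPTIMAL-WEIGHT logarithmic volume law
`Scaling/AutoregressiveGaugeKLExtensiveAllPlanesLogMass` with the tree's explicit `SU(3)` inputs — the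
plaquette floor `w = 1 − δ_K`, `δ_K = (17 + 3 log K)/K`
(`Scaling/SU3HaarSmallBall.wilsonExpectation_plaquette_ge_su3`) and the sharp-order small-ball sandwich
`r⁸/(64000π⁸) ≤ Haar{‖U − 1‖_F ≤ r} ≤ (16/3)·r⁸` (`Scaling/SU3HaarSmallBall`,
`Scaling/SU3HaarSmallBallUpperSharp`).  With a free parameter `t ≥ 2` and the radius `ε² = 6tδ_K` the
Chebyshev mass is `u = 1 − 1/t`, so per counted link the loss is at least
`(1 − 1/t)·(log(3/(16ε⁸)) + log(1 − 1/t)) − (log t)/t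
= (1 − 1/t)·(4·log(1/δ_K) − 4·log t − 8·log 2 − 3·log 3 + log(1 − 1/t)) − (log t)/t`:
the coefficient of `log(1/δ_K) ∼ log β` is `4·(1 − 1/t) → dim SU(3)/2`, against `3/2` in the half-weight law.

## What is proved (all [ours]; `SU(3)` = `Matrix.specialUnitaryGroup (Fin 3) ℂ` in `fundamentalRep (Fin 3)`,
`d ≥ 2`, `L ≥ 2`, `K = (d−1)β ≥ 2`, `t ≥ 2` with `t·δ_K ≤ 1/3` and the rate non-negative; squeezed
normalised conditionals `q_a` not reading later links of a duplicate-free order `l` of ALL links, each `q_e`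
blind to the other links at an endpoint `Y e` of `e`)

* **`su3_log_inv_ball_ge`** — `0 < ε`, `ε² ≤ 2`: `0 < φ₃(ε)` and `log(3/(16ε⁸)) ≤ log(1/φ₃(ε))`.
* **`su3_kl_arHybrid_ge_logSharp`** —
  `(d·L^d/4)·((1 − 1/t)·(4·log(K/(17 + 3 log K)) − 4·log t − 8·log 2 − 3·log 3 + log(1 − 1/t)) − (log t)/t) ≤ KL`.
* **`su3_tauInt_sign_ge_exp_logSharp`** — `exp(the same) − ½ ≤ τ_int(g)` for every measurable balanced sign
  observable `g` of the exact sampler.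

READING (value-free): taking `t` slowly growing with `K` (admissible while `t·δ_K ≤ 1/3`) the exponent per
site is `(d/4)·(4 − o(1))·log K` — the dimension of `SU(3)` over two, the concentration exponent of one
plaquette variable at weak coupling.  NOT CLAIMED: conditioners reading both endpoints; any `β` outside the
stated window; optimality of the combinatorial factor `d/4`.  No `def`, no `sorry`, nothing cited as a fact
beyond the tree.
-/

noncomputable section

namespace Summit.Ventures.LatticeQCDFlow.Theory2.Autoregressive

open MeasureTheory Function Set
open Literature.MathematicalPhysics.QuantumFieldTheory Literature.MathematicalPhysics.QuantumLattice
open Summit.Ventures.LatticeQCDFlow.Exactness Summit.Ventures.LatticeQCDFlow.Scoring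
open scoped Matrix Matrix.Norms.Frobenius

variable {d L : ℕ} [NeZero L]

/-- **Explicit SU(3) small-ball sandwich.**  For `0 < ε` with `ε² ≤ 2`: `0 < φ₃(ε) = Haar{‖U − 1‖_F ≤ ε}`
and `log(3/(16ε⁸)) ≤ log(1/φ₃(ε))` (the sharp-order sandwich `ε⁸/(64000π⁸) ≤ φ₃(ε) ≤ (16/3)ε⁸`). [ours] -/
theorem su3_log_inv_ball_ge {ε : ℝ} (hε : 0 < ε) (hε2 : ε ^ 2 ≤ 2) :
    0 < (haarProbability (Matrix.specialUnitaryGroup (Fin 3) ℂ)).real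
        {g : Matrix.specialUnitaryGroup (Fin 3) ℂ | ‖fundamentalRep (Fin 3) g - 1‖ ≤ ε} ∧
      Real.log (3 / (16 * ε ^ 8)) ≤
        Real.log (1 / (haarProbability (Matrix.specialUnitaryGroup (Fin 3) ℂ)).real
          {g : Matrix.specialUnitaryGroup (Fin 3) ℂ | ‖fundamentalRep (Fin 3) g - 1‖ ≤ ε}) := by
  set μ := haarProbability (Matrix.specialUnitaryGroup (Fin 3) ℂ) with hμ
  set Bε : Set (Matrix.specialUnitaryGroup (Fin 3) ℂ) :=
    {g | ‖fundamentalRep (Fin 3) g - 1‖ ≤ ε} with hBε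
  have hlo : ε ^ 8 / (64000 * Real.pi ^ 8) ≤ μ.real Bε :=
    Theory2.WeakCoupling.haarProbability_real_ball_ge_su3 hε hε2
  have hφ0 : 0 < μ.real Bε := lt_of_lt_of_le (by positivity) hlo
  refine ⟨hφ0, ?_⟩
  have hup : μ.real Bε ≤ 16 / 3 * ε ^ 8 := Theory2.WeakCoupling.haarProbability_real_ball_le_su3_sharp hε hε2
  apply Real.log_le_log (by positivity)
  rw [show (3 : ℝ) / (16 * ε ^ 8) = 1 / (16 / 3 * ε ^ 8) by field_simp]
  exact one_div_le_one_div_of_le hφ0 hup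

/-- **THE `SU(3)` VOLUME LAW WITH THE FULL LOGARITHMIC COEFFICIENT.**  `d ≥ 2`, `L ≥ 2`, `K = (d−1)β ≥ 2`,
`t ≥ 2` with `t·(17 + 3 log K)/K ≤ 1/3` and
`0 ≤ m_t = (1 − 1/t)·(4·log(K/(17 + 3 log K)) − 4·log t − 8·log 2 − 3·log 3 + log(1 − 1/t)) − (log t)/t`;
any duplicate-free order `l` of all links; squeezed normalised conditionals not reading later links, each
blind to the other links at an endpoint `Y e` of its link.  Then `(d·L^d/4)·m_t ≤ KL`. [ours] -/
theorem su3_kl_arHybrid_ge_logSharp (hd : 2 ≤ d) (hL : 2 ≤ L) {β : ℝ}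
    (hK : 2 ≤ ((d : ℝ) - 1) * β) {t : ℝ} (ht : 2 ≤ t)
    (htK : t * ((17 + 3 * Real.log (((d : ℝ) - 1) * β)) / (((d : ℝ) - 1) * β)) ≤ 1 / 3)
    (hrate : 0 ≤ (1 - 1 / t) * (4 * Real.log (((d : ℝ) - 1) * β / (17 + 3 * Real.log (((d : ℝ) - 1) * β))) -
      4 * Real.log t - 8 * Real.log 2 - 3 * Real.log 3 + Real.log (1 - 1 / t)) - Real.log t / t)
    {q : Edge d L → GaugeConfig d L (Matrix.specialUnitaryGroup (Fin 3) ℂ) → ℝ}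
    (hqm : ∀ a, Measurable (q a)) {cq Cq : ℝ} (hcq : 0 < cq)
    (hqlo : ∀ a U, cq ≤ q a U) (hqhi : ∀ a U, q a U ≤ Cq)
    (hq1 : ∀ a U, ∫ v, q a (update U a v) ∂(haarProbability (Matrix.specialUnitaryGroup (Fin 3) ℂ)) = 1)
    (l : List (Edge d L)) (hl : l.Nodup) (hall : ∀ e : Edge d L, e ∈ l)
    (hpw : l.Pairwise (fun a b => ∀ (U : GaugeConfig d L (Matrix.specialUnitaryGroup (Fin 3) ℂ))
      (v : Matrix.specialUnitaryGroup (Fin 3) ℂ), q a (update U b v) = q a U))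
    (Y : Edge d L → Site d L) (hY : ∀ e : Edge d L, e.1 = Y e ∨ e.1.shift e.2 = Y e)
    (hqB : ∀ e e' : Edge d L, e'.1 = Y e ∨ e'.1.shift e'.2 = Y e → e' ≠ e →
      ∀ (U : GaugeConfig d L (Matrix.specialUnitaryGroup (Fin 3) ℂ)) (v : Matrix.specialUnitaryGroup (Fin 3) ℂ),
        q e (update U e' v) = q e U) :
    (d : ℝ) * (L : ℝ) ^ d / 4 *
        ((1 - 1 / t) * (4 * Real.log (((d : ℝ) - 1) * β / (17 + 3 * Real.log (((d : ℝ) - 1) * β))) -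
          4 * Real.log t - 8 * Real.log 2 - 3 * Real.log 3 + Real.log (1 - 1 / t)) - Real.log t / t) ≤
      ∫ U, Real.exp (-β * wilsonAction (fundamentalRep (Fin 3)) U) /
            (∫ W, Real.exp (-β * wilsonAction (fundamentalRep (Fin 3)) W)
              ∂Measure.pi (fun _ : Edge d L => haarProbability (Matrix.specialUnitaryGroup (Fin 3) ℂ))) *
          Real.log ((Real.exp (-β * wilsonAction (fundamentalRep (Fin 3)) U) /
              ∫ W, Real.exp (-β * wilsonAction (fundamentalRep (Fin 3)) W)
                ∂Measure.pi (fun _ : Edge d L => haarProbability (Matrix.specialUnitaryGroup (Fin 3) ℂ))) /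
            ((l.map fun b => q b U).prod *
                coordAvg (haarProbability (Matrix.specialUnitaryGroup (Fin 3) ℂ)) l.toFinset
                  (fun V : GaugeConfig d L (Matrix.specialUnitaryGroup (Fin 3) ℂ) =>
                    Real.exp (-β * wilsonAction (fundamentalRep (Fin 3)) V)) U /
              ∫ W, Real.exp (-β * wilsonAction (fundamentalRep (Fin 3)) W)
                ∂Measure.pi (fun _ : Edge d L => haarProbability (Matrix.specialUnitaryGroup (Fin 3) ℂ))))
        ∂Measure.pi (fun _ : Edge d L => haarProbability (Matrix.specialUnitaryGroup (Fin 3) ℂ)) := by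
  haveI : SecondCountableTopology (Matrix (Fin 3) (Fin 3) ℂ) :=
    inferInstanceAs (SecondCountableTopology (Fin 3 → Fin 3 → ℂ))
  haveI : SecondCountableTopology (Matrix.specialUnitaryGroup (Fin 3) ℂ) :=
    Topology.IsEmbedding.subtypeVal.secondCountableTopology
  set K : ℝ := ((d : ℝ) - 1) * β with hKdef
  set δ : ℝ := (17 + 3 * Real.log K) / K with hδ
  have hKpos : 0 < K := by linarith
  have hlogK : 0 ≤ Real.log K := Real.log_nonneg (by linarith)
  have h98 : 0 < 17 + 3 * Real.log K := by positivity
  have hδpos : 0 < δ := by rw [hδ]; positivity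
  have htpos : 0 < t := by linarith
  -- the radius `ε² = 6tδ ≤ 2`
  set ε : ℝ := Real.sqrt (6 * t * δ) with hεdef
  have hε : 0 < ε := Real.sqrt_pos.2 (by positivity)
  have hε2 : ε ^ 2 = 6 * t * δ := by rw [hεdef, Real.sq_sqrt (by positivity)]
  have hε2le : ε ^ 2 ≤ 2 := by
    rw [hε2]
    have : t * δ ≤ 1 / 3 := htK
    linarith
  obtain ⟨hφ0, hball⟩ := su3_log_inv_ball_ge hε hε2le
  -- the plaquette floor `w = 1 − δ`
  have hw : ∀ p : Plaquette d L, 1 - δ ≤ wilsonExpectation (fundamentalRep (Fin 3)) β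
      (fun U : GaugeConfig d L (Matrix.specialUnitaryGroup (Fin 3) ℂ) =>
        ((3 : ℕ) : ℝ)⁻¹ * (fundamentalRep (Fin 3) (plaquetteHolonomy U p.1 p.2.1.1 p.2.1.2)).trace.re) :=
    fun p => Theory2.WeakCoupling.wilsonExpectation_plaquette_ge_su3 hd hK p.1 (ne_of_lt p.2.2)
  have hw1 : 1 - δ < 1 := by linarith
  have hwε : 4 * ((3 : ℕ) : ℝ) * (1 - (1 - δ)) ≤ ε ^ 2 := by
    rw [hε2]; push_cast; nlinarith
  -- the Chebyshev mass is `u = 1 − 1/t`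
  have hueq : (1 : ℝ) - 2 * ((3 : ℕ) : ℝ) * (1 - (1 - δ)) / ε ^ 2 = 1 - 1 / t := by
    rw [hε2]; push_cast; field_simp; ring
  set φ : ℝ := (haarProbability (Matrix.specialUnitaryGroup (Fin 3) ℂ)).real
    {g : Matrix.specialUnitaryGroup (Fin 3) ℂ | ‖fundamentalRep (Fin 3) g - 1‖ ≤ ε} with hφ
  set m : ℝ := (1 - 1 / t) * (4 * Real.log (K / (17 + 3 * Real.log K)) - 4 * Real.log t -
      8 * Real.log 2 - 3 * Real.log 3 + Real.log (1 - 1 / t)) - Real.log t / t with hm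
  -- `log(3/(16ε⁸)) = 4·log(K/(17 + 3 log K)) − 4·log t − 8·log 2 − 3·log 3`
  have e1 : Real.log (3 / (16 * ε ^ 8)) =
      4 * Real.log (K / (17 + 3 * Real.log K)) - 4 * Real.log t - 8 * Real.log 2 - 3 * Real.log 3 := by
    have hε6 : ε ^ 8 = (ε ^ 2) ^ 4 := by ring
    have hlog6tδ : Real.log (6 * t * δ) = Real.log 2 + Real.log 3 + Real.log t + Real.log δ := by
      rw [Real.log_mul (by positivity) hδpos.ne', Real.log_mul (by norm_num) htpos.ne',
        show Real.log (6 : ℝ) = Real.log 2 + Real.log 3 by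
          rw [show (6 : ℝ) = 2 * 3 by norm_num, Real.log_mul (by norm_num) (by norm_num)]]
    have hlogδ : Real.log δ = -Real.log (K / (17 + 3 * Real.log K)) := by
      rw [hδ, Real.log_div h98.ne' hKpos.ne', Real.log_div hKpos.ne' h98.ne']
      ring
    rw [Real.log_div (by norm_num) (by positivity), Real.log_mul (by norm_num) (by positivity), hε6,
      Real.log_pow, hε2, hlog6tδ, hlogδ,
      show Real.log (16 : ℝ) = 4 * Real.log 2 by
        rw [show (16 : ℝ) = 2 ^ 4 by norm_num, Real.log_pow]; norm_num]
    push_cast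
    ring
  -- our rate is below the optimal-weight rate at `u = 1 − 1/t`
  have h1t2 : 1 / t ≤ 1 / 2 := one_div_le_one_div_of_le (by norm_num) ht
  have h1t : 0 ≤ 1 - 1 / t := by linarith
  have h1tpos : (0 : ℝ) < 1 - 1 / t := by linarith
  have hrate' : m ≤ (1 - 1 / t) * Real.log ((1 - 1 / t) / φ) + (1 - (1 - 1 / t)) * Real.log (1 - (1 - 1 / t)) := by
    have hlog1φ : Real.log (1 / φ) = -Real.log φ := by rw [one_div, Real.log_inv]
    have hsplit : Real.log ((1 - 1 / t) / φ) = Real.log (1 - 1 / t) + Real.log (1 / φ) := by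
      rw [hlog1φ, Real.log_div h1tpos.ne' hφ0.ne']
      ring
    have hlog1t : Real.log (1 / t) = -Real.log t := by rw [one_div, Real.log_inv]
    have hlast : (1 - (1 - 1 / t)) * Real.log (1 - (1 - 1 / t)) = -(Real.log t / t) := by
      rw [show (1 : ℝ) - (1 - 1 / t) = 1 / t by ring, hlog1t]
      ring
    rw [hsplit, hlast, hm, ← e1]
    nlinarith [hball, h1t]
  have hm0 : 0 ≤ (1 - 1 / t) * Real.log ((1 - 1 / t) / φ) + (1 - (1 - 1 / t)) * Real.log (1 - (1 - 1 / t)) :=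
    hrate.trans hrate'
  have hm0' : 0 ≤ (1 - 2 * ((3 : ℕ) : ℝ) * (1 - (1 - δ)) / ε ^ 2) *
        Real.log ((1 - 2 * ((3 : ℕ) : ℝ) * (1 - (1 - δ)) / ε ^ 2) / φ) +
      (1 - (1 - 2 * ((3 : ℕ) : ℝ) * (1 - (1 - δ)) / ε ^ 2)) *
        Real.log (1 - (1 - 2 * ((3 : ℕ) : ℝ) * (1 - (1 - δ)) / ε ^ 2)) := by
    rw [hueq]; exact hm0
  have hmain := wilson_kl_arHybrid_ge_dim_mul_card_site_mul_ballLog_of_floor_mass (d := d) (L := L)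
    (fundamentalRep (Fin 3)) hd (by norm_num) (continuous_fundamentalRep (Fin 3)) fundamentalRep_mem_unitaryGroup
    hL β hε hφ0 hw hw1 hwε hm0' hqm hcq hqlo hqhi hq1 l hl hall hpw Y hY hqB
  rw [hueq] at hmain
  have hcardSite : Fintype.card (Site d L) = L ^ d := by simp [Site, ZMod.card]
  rw [hcardSite] at hmain
  push_cast at hmain
  have hcard : 0 ≤ (d : ℝ) * (L : ℝ) ^ d / 4 := by positivity
  exact (mul_le_mul_of_nonneg_left hrate' hcard).trans hmain

set_option maxHeartbeats 400000 in
/-- **THE `SU(3)` EXPONENTIAL SLOWING DOWN WITH THE FULL LOGARITHMIC COEFFICIENT.**  Under the hypotheses of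
`su3_kl_arHybrid_ge_logSharp`, for every measurable balanced sign observable `g` of the exact independence
sampler: `exp((d·L^d/4)·m_t) − ½ ≤ τ_int(g)`. [ours] -/
theorem su3_tauInt_sign_ge_exp_logSharp (hd : 2 ≤ d) (hL : 2 ≤ L) {β : ℝ}
    (hK : 2 ≤ ((d : ℝ) - 1) * β) {t : ℝ} (ht : 2 ≤ t)
    (htK : t * ((17 + 3 * Real.log (((d : ℝ) - 1) * β)) / (((d : ℝ) - 1) * β)) ≤ 1 / 3)
    (hrate : 0 ≤ (1 - 1 / t) * (4 * Real.log (((d : ℝ) - 1) * β / (17 + 3 * Real.log (((d : ℝ) - 1) * β))) -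
      4 * Real.log t - 8 * Real.log 2 - 3 * Real.log 3 + Real.log (1 - 1 / t)) - Real.log t / t)
    {q : Edge d L → GaugeConfig d L (Matrix.specialUnitaryGroup (Fin 3) ℂ) → ℝ}
    (hqm : ∀ a, Measurable (q a)) {cq Cq : ℝ} (hcq : 0 < cq)
    (hqlo : ∀ a U, cq ≤ q a U) (hqhi : ∀ a U, q a U ≤ Cq)
    (hq1 : ∀ a U, ∫ v, q a (update U a v) ∂(haarProbability (Matrix.specialUnitaryGroup (Fin 3) ℂ)) = 1)
    (l : List (Edge d L)) (hl : l.Nodup) (hall : ∀ e : Edge d L, e ∈ l)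
    (hpw : l.Pairwise (fun a b => ∀ (U : GaugeConfig d L (Matrix.specialUnitaryGroup (Fin 3) ℂ))
      (v : Matrix.specialUnitaryGroup (Fin 3) ℂ), q a (update U b v) = q a U))
    (Y : Edge d L → Site d L) (hY : ∀ e : Edge d L, e.1 = Y e ∨ e.1.shift e.2 = Y e)
    (hqB : ∀ e e' : Edge d L, e'.1 = Y e ∨ e'.1.shift e'.2 = Y e → e' ≠ e →
      ∀ (U : GaugeConfig d L (Matrix.specialUnitaryGroup (Fin 3) ℂ)) (v : Matrix.specialUnitaryGroup (Fin 3) ℂ),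
        q e (update U e' v) = q e U)
    {g : GaugeConfig d L (Matrix.specialUnitaryGroup (Fin 3) ℂ) → ℝ} (hgm : Measurable g)
    (hg1 : ∀ U, g U ^ 2 = 1)
    (hg0 : ∫ U, g U * Real.exp (-β * wilsonAction (fundamentalRep (Fin 3)) U)
      ∂Measure.pi (fun _ : Edge d L => haarProbability (Matrix.specialUnitaryGroup (Fin 3) ℂ)) = 0) :
    Real.exp ((d : ℝ) * (L : ℝ) ^ d / 4 *
        ((1 - 1 / t) * (4 * Real.log (((d : ℝ) - 1) * β / (17 + 3 * Real.log (((d : ℝ) - 1) * β))) -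
          4 * Real.log t - 8 * Real.log 2 - 3 * Real.log 3 + Real.log (1 - 1 / t)) - Real.log t / t)) - 1 / 2 ≤
      tauInt (fun k => (∫ U, g U *
          ((imhOp (Measure.pi fun _ : Edge d L => haarProbability (Matrix.specialUnitaryGroup (Fin 3) ℂ))
            (fun V : GaugeConfig d L (Matrix.specialUnitaryGroup (Fin 3) ℂ) =>
              Real.exp (-β * wilsonAction (fundamentalRep (Fin 3)) V))
            (fun V : GaugeConfig d L (Matrix.specialUnitaryGroup (Fin 3) ℂ) => (l.map fun b => q b V).prod *
                coordAvg (haarProbability (Matrix.specialUnitaryGroup (Fin 3) ℂ)) l.toFinset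
                  (fun V' : GaugeConfig d L (Matrix.specialUnitaryGroup (Fin 3) ℂ) =>
                    Real.exp (-β * wilsonAction (fundamentalRep (Fin 3)) V')) V /
              ∫ W, Real.exp (-β * wilsonAction (fundamentalRep (Fin 3)) W)
                ∂Measure.pi (fun _ : Edge d L => haarProbability (Matrix.specialUnitaryGroup (Fin 3) ℂ))))^[k]
            g) U * Real.exp (-β * wilsonAction (fundamentalRep (Fin 3)) U)
          ∂Measure.pi (fun _ : Edge d L => haarProbability (Matrix.specialUnitaryGroup (Fin 3) ℂ))) /
          ∫ U, g U ^ 2 * Real.exp (-β * wilsonAction (fundamentalRep (Fin 3)) U)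
            ∂Measure.pi (fun _ : Edge d L => haarProbability (Matrix.specialUnitaryGroup (Fin 3) ℂ))) := by
  haveI : SecondCountableTopology (Matrix (Fin 3) (Fin 3) ℂ) :=
    inferInstanceAs (SecondCountableTopology (Fin 3 → Fin 3 → ℂ))
  haveI : SecondCountableTopology (Matrix.specialUnitaryGroup (Fin 3) ℂ) :=
    Topology.IsEmbedding.subtypeVal.secondCountableTopology
  obtain ⟨hFm, B, hFlo, hFhi⟩ := wilsonWeight_props (d := d) (L := L) (fundamentalRep (Fin 3))
    (continuous_fundamentalRep (Fin 3)) β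
  have hkl := su3_kl_arHybrid_ge_logSharp (d := d) (L := L) hd hL hK ht htK hrate hqm hcq hqlo hqhi hq1 l hl
    hall hpw Y hY hqB
  have htau := arHybrid_exp_kl_le_tauInt_sign (haarProbability (Matrix.specialUnitaryGroup (Fin 3) ℂ)) hqm
    hcq hqlo hqhi hq1 hFm (Real.exp_pos _) hFlo hFhi l hpw hgm hg1 hg0
  exact le_trans (sub_le_sub_right (Real.exp_le_exp.2 hkl) _) htau

end Summit.Ventures.LatticeQCDFlow.Theory2.Autoregressive

end
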